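import Literature.Analysis.FluidPDE.NSBoundedMildOseenRestart
import Literature.Analysis.FluidPDE.OseenKernelLp
import Literature.Analysis.FluidPDE.KatoBilinearEstimates
import Literature.Analysis.FluidPDE.MildL3Restart
import Literature.Analysis.FunctionSpaces.MinkowskiIntegral
import Literature.Analysis.UnboundedOperators.HeatKernelLpSmoothingProofs
import HarnessLib

/-!
# The heat low-pass of the Oseen–Duhamel term through the energy, and `L²` decay of the free flow

Analysis/FluidPDE proof file (theorems only; no definitions, no named facts). First of three files
proving the `L²` decay `‖u(t)‖₂ → 0` of finite-energy classical solutions of Navier–Stokes on `ℝ³`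
(Masuda 1984; Kato 1984, §4) — see `FiniteEnergyClassicalL2Decay.lean` for the theorem and the
whole argument. This file holds the linear and bilinear `L²` tools, all in dimension three:

* `EnergyDecay.tendsto_eLpNorm_two_heatExtension_atTop` — `‖e^{σΔ}g‖₂ → 0` (`σ → ∞`) for `g ∈ L²`
  (no rate; density + `L¹ → L²` smoothing + contraction, copied from the tree's `L³` version
  `GIP2003.tendsto_eLpNorm_heatExtension_three_atTop`);
* `EnergyDecay.exists_eLpNorm_two_oseenSlice_le_eLpNorm_one` — the `L¹ → L²` endpoint of Kato's
  slice bounds, `‖N_σ[a, b]‖₂ ≤ C σ^{-5/4} ‖|a||b|‖₁` (Kato 1984, (2.3)–(2.4′); the tree's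
  `exists_eLpNorm_oseenSlice_le` starts at `p > 1`);
* `EnergyDecay.exists_eLpNorm_two_heat_oseenDuhamel_le` — for a jointly measurable field `w` with
  `∫|w(τ)|² ≤ A` on `(0, t)`: `‖∫₀ᵗ N_{ν(t+s-τ)}[w(τ), w(τ)] dτ‖₂ ≤ A · 4C ν^{-5/4} s^{-1/4}`,
  uniformly in `t` (Minkowski in time + the tail integral `EnergyDecay.lintegral_decayWeight_le`);
* `EnergyDecay.exists_clamp_heatExtension_oseenDuhamel_eq` — for a field continuous and bounded on
  `[0, T] × ℝ³`: `e^{νsΔ} B^ν_0(u,u)(t) = ∫₀ᵗ N_{ν(t+s-τ)}[w, w] dτ` with `w` the time-clamped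
  (globally measurable, bounded) copy of `u` (the tree's semigroup law
  `heatExtension_oseenDuhamel_eq_setIntegral`, KNSS 2009 §4 / Lemarié-Rieusset 2016 Prop. 6.4).

## References

* T. Kato, Math. Z. 187 (1984) 471–480, §2 (2.3)–(2.4′), §4. [Kato1984]
* P. G. Lemarié-Rieusset, *The Navier–Stokes Problem in the 21st Century* (2016), Prop. 6.4 (6.10).
  [LemarieRieusset2016]
* G. Koch, N. Nadirashvili, G. Seregin, V. Šverák, Acta Math. 203 (2009), §4. [KochNadirashviliSereginSverak2009]
-/

noncomputable section

open MeasureTheory Set Function Filter Metric Real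
open _root_.Topology
open scoped ENNReal NNReal

namespace Literature.Analysis.FluidPDE

open UnboundedOperators (heatKernel heatExtension)

namespace EnergyDecay

/-! ### 1. The free heat flow of an `L²` field decays in `L²` -/

/-- **The caloric extension of an `L²(ℝ³)` field tends to zero in `L²`**: `‖e^{σΔ}g‖₂ → 0` as
`σ → ∞` (density of compactly supported continuous fields in `L²`, the `L¹ → L²` smoothing bound
`‖e^{σΔ}h‖₂ ≤ C σ^{-3/4}‖h‖₁` in dimension three and the `L²` contraction of the heat semigroup).
No rate is asserted (none exists uniformly on `L²` data). [cite: GigaGigaSaal2010, §1.1.3] -/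
theorem tendsto_eLpNorm_two_heatExtension_atTop
    {g : EuclideanSpace ℝ (Fin 3) → EuclideanSpace ℝ (Fin 3)} (hg : MemLp g 2 volume) :
    Tendsto (fun σ : ℝ => eLpNorm (heatExtension g σ) 2 volume) atTop (𝓝 0) := by
  obtain ⟨C, hC⟩ := UnboundedOperators.eLpNorm_heatExtension_le_rpow_holds (EuclideanSpace ℝ (Fin 3))
    (EuclideanSpace ℝ (Fin 3)) (p := 1) (q := 2) le_rfl (by norm_num)
  have hexp : ∀ r : ℝ, 0 < r →
      r ^ (-((Module.finrank ℝ (EuclideanSpace ℝ (Fin 3)) : ℝ) / 2) *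
        ((1 / (1 : ℝ≥0∞)).toReal - (1 / (2 : ℝ≥0∞)).toReal)) = r ^ (-(3 / 4 : ℝ)) := by
    intro r _
    congr 1
    rw [finrank_euclideanSpace_fin]
    norm_num [ENNReal.toReal_div]
  have h12 : (1 : ℝ≥0∞) ≤ 2 := by norm_num
  rw [ENNReal.tendsto_nhds_zero]
  intro ε hε
  have hε2 : ε / 2 ≠ 0 := (ENNReal.half_pos hε.ne').ne'
  -- a compactly supported continuous approximation
  obtain ⟨h, hhs, hgh, hhc, hh2⟩ := hg.exists_hasCompactSupport_eLpNorm_sub_le (by norm_num) hε2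
  have hh1 : MemLp h 1 volume := hhc.memLp_of_hasCompactSupport hhs
  -- the smoothing bound for `h` tends to zero
  have hbound : Tendsto (fun σ : ℝ => (C : ℝ≥0∞) * ENNReal.ofReal (σ ^ (-(3 / 4 : ℝ))) *
      eLpNorm h 1 volume) atTop (𝓝 0) := by
    have h1 : Tendsto (fun σ : ℝ => σ ^ (-(3 / 4 : ℝ))) atTop (𝓝 0) :=
      tendsto_rpow_neg_atTop (by norm_num)
    have h1' : Tendsto (fun σ : ℝ => ENNReal.ofReal (σ ^ (-(3 / 4 : ℝ)))) atTop (𝓝 0) := by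
      simpa using ENNReal.tendsto_ofReal h1
    have h2 : Tendsto (fun σ : ℝ => (C : ℝ≥0∞) * ENNReal.ofReal (σ ^ (-(3 / 4 : ℝ)))) atTop
        (𝓝 0) := by
      simpa using ENNReal.Tendsto.const_mul h1' (Or.inr ENNReal.coe_ne_top)
    simpa using ENNReal.Tendsto.mul_const h2 (Or.inr hh1.eLpNorm_ne_top)
  have hev : ∀ᶠ σ : ℝ in atTop, (C : ℝ≥0∞) * ENNReal.ofReal (σ ^ (-(3 / 4 : ℝ))) *
      eLpNorm h 1 volume ≤ ε / 2 :=
    ENNReal.tendsto_nhds_zero.1 hbound (ε / 2) (ENNReal.half_pos hε.ne')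
  filter_upwards [eventually_gt_atTop 0, hev] with σ hσ hσε
  have hsplit : heatExtension g σ = heatExtension (g - h) σ + heatExtension h σ := by
    rw [← heatExtension_add_eq_of_memLp (hg.sub hh2) hh2 h12 hσ, sub_add_cancel]
  have hm1 : MemLp (heatExtension (g - h) σ) 2 volume :=
    UnboundedOperators.memLp_heatExtension_holds (hg.sub hh2) h12 hσ
  have hm2 : MemLp (heatExtension h σ) 2 volume :=
    UnboundedOperators.memLp_heatExtension_holds hh2 h12 hσ
  have hcontr : eLpNorm (heatExtension (g - h) σ) 2 volume ≤ ε / 2 :=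
    (UnboundedOperators.eLpNorm_heatExtension_le_holds (hg.sub hh2) h12 hσ).trans hgh
  have hsmooth : eLpNorm (heatExtension h σ) 2 volume ≤ ε / 2 := by
    have h1 := hC h hh1 σ hσ
    rw [hexp σ hσ] at h1
    exact h1.trans hσε
  calc eLpNorm (heatExtension g σ) 2 volume
      ≤ eLpNorm (heatExtension (g - h) σ) 2 volume + eLpNorm (heatExtension h σ) 2 volume := by
        rw [hsplit]
        exact eLpNorm_add_le hm1.1 hm2.1 h12
    _ ≤ ε / 2 + ε / 2 := add_le_add hcontr hsmooth
    _ = ε := ENNReal.add_halves ε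

/-- **Monotonicity of the free `L²` norm along the heat flow**: `‖e^{(σ+τ)Δ}g‖₂ ≤ ‖e^{σΔ}g‖₂` for
`g ∈ L²`, `σ, τ > 0` (semigroup law and `L²` contraction). [cite: GigaGigaSaal2010, §1.1.2] -/
theorem eLpNorm_two_heatExtension_add_le
    {g : EuclideanSpace ℝ (Fin 3) → EuclideanSpace ℝ (Fin 3)} (hg : MemLp g 2 volume)
    {σ τ : ℝ} (hσ : 0 < σ) (hτ : 0 < τ) :
    eLpNorm (heatExtension g (σ + τ)) 2 volume ≤ eLpNorm (heatExtension g σ) 2 volume := by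
  have h12 : (1 : ℝ≥0∞) ≤ 2 := by norm_num
  rw [← UnboundedOperators.heatExtension_add_holds hg h12 hσ hτ]
  exact UnboundedOperators.eLpNorm_heatExtension_le_holds
    (UnboundedOperators.memLp_heatExtension_holds hg h12 hσ) h12 hτ

/-! ### 2. The Oseen slice operator from `L¹` to `L²`: `‖N_σ[a, b]‖₂ ≤ C σ^{-5/4} ‖|a| |b|‖₁` -/

/-- **The `L¹ → L²` bound of the Oseen slice operator in dimension three** (the endpoint `p = 1`,
`q = 2` of Kato 1984, (2.3)–(2.4′) / Lemarié-Rieusset 2016, Prop. 6.4 (6.10): Minkowski's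
inequality with the `L²` size `∝ σ^{3/4 - 2} = σ^{-5/4}` of the parabolic envelope
`C (σ + ‖z‖²)^{-2}` of the Oseen–Koch–Tataru kernel): there is `C ≥ 0` with
`‖N_σ[a, b]‖_{L²} ≤ C σ^{-5/4} ‖ |a| |b| ‖_{L¹}` for all `σ > 0` and all a.e.-strongly measurable
fields `a, b` on `ℝ³`. [cite: Kato1984, §2 (2.3)–(2.4')] [cite: LemarieRieusset2016, Prop. 6.4 (6.10)] -/
theorem exists_eLpNorm_two_oseenSlice_le_eLpNorm_one :
    ∃ C : ℝ, 0 ≤ C ∧ ∀ {σ : ℝ}, 0 < σ →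
      ∀ {a b : EuclideanSpace ℝ (Fin 3) → EuclideanSpace ℝ (Fin 3)},
        AEStronglyMeasurable a volume → AEStronglyMeasurable b volume →
          eLpNorm (fun x => ∫ y, oseenKernel σ (x - y) (a y) (b y)) 2 volume ≤
            ENNReal.ofReal (C * σ ^ (-(5 / 4 : ℝ))) *
              eLpNorm (fun y => ‖a y‖ * ‖b y‖) 1 volume := by
  obtain ⟨C, hC, hK⟩ := exists_norm_oseenKernel_le (E := EuclideanSpace ℝ (Fin 3))
  obtain ⟨C₂, hC₂, hEnv⟩ := exists_eLpNorm_oseenEnvelope_le (E := EuclideanSpace ℝ (Fin 3)) hC.le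
    (r := 2) (by norm_num) (by norm_num)
  refine ⟨C₂, hC₂, fun {σ} hσ {a} {b} ha hb => ?_⟩
  set Env : EuclideanSpace ℝ (Fin 3) → ℝ :=
    fun z => C * (σ + ‖z‖ ^ 2) ^ (-(((Module.finrank ℝ (EuclideanSpace ℝ (Fin 3)) : ℝ) + 1) / 2))
    with hEnvdef
  set f : EuclideanSpace ℝ (Fin 3) → ℝ := fun y => ‖a y‖ * ‖b y‖ with hfdef
  have hEnvm : AEStronglyMeasurable Env volume :=
    (measurable_const.mul ((measurable_const.add (measurable_norm.pow_const 2)).pow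
      measurable_const)).aestronglyMeasurable
  have hfm : AEStronglyMeasurable f volume := (ha.norm.mul hb.norm)
  -- domination with the roles of kernel and datum exchanged: `‖N_σ(x)‖ ≤ ∫ |f(y)| Env(x - y) dy`
  have hdom : ∀ x, ‖∫ y, oseenKernel σ (x - y) (a y) (b y)‖ₑ ≤
      ∫⁻ y, ‖f y‖ₑ * ‖Env (x - y)‖ₑ := by
    intro x
    have h := enorm_oseenSlice_le_lintegral hC.le hK hσ a b x
    have hswap : ∫⁻ y, ‖Env y‖ₑ * ‖f (x - y)‖ₑ = ∫⁻ y, ‖f y‖ₑ * ‖Env (x - y)‖ₑ := by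
      have := lintegral_sub_left_eq_self (μ := (volume : Measure (EuclideanSpace ℝ (Fin 3))))
        (fun y => ‖f y‖ₑ * ‖Env (x - y)‖ₑ) x
      simp only [sub_sub_cancel] at this
      rw [← this]
      refine lintegral_congr fun y => ?_
      rw [mul_comm]
    rw [← hswap]
    exact h
  have hmink := eLpNorm_le_lintegral_mul_eLpNorm_of_dominated (μ := volume) hfm hEnvm hdom
    (p := 2) (by norm_num)
  -- `∫ |f| = ‖f‖₁` and the `L²` size of the envelope
  have hf1 : ∫⁻ y, ‖f y‖ₑ = eLpNorm f 1 volume := by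
    rw [eLpNorm_one_eq_lintegral_enorm]
  have hexp : (Module.finrank ℝ (EuclideanSpace ℝ (Fin 3)) : ℝ) / (2 * (2 : ℝ≥0∞).toReal) -
      ((Module.finrank ℝ (EuclideanSpace ℝ (Fin 3)) : ℝ) + 1) / 2 = -(5 / 4 : ℝ) := by
    rw [finrank_euclideanSpace_fin]
    norm_num
  have hE2 := hEnv σ hσ
  rw [hexp] at hE2
  calc eLpNorm (fun x => ∫ y, oseenKernel σ (x - y) (a y) (b y)) 2 volume
      ≤ (∫⁻ y, ‖f y‖ₑ) * eLpNorm Env 2 volume := hmink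
    _ ≤ eLpNorm f 1 volume * ENNReal.ofReal (C₂ * σ ^ (-(5 / 4 : ℝ))) := by
        rw [hf1]; gcongr
    _ = ENNReal.ofReal (C₂ * σ ^ (-(5 / 4 : ℝ))) * eLpNorm f 1 volume := mul_comm _ _

/-- **`‖ |a| |a| ‖_{L¹} = ∫ |a|²` as an extended real** for an a.e.-strongly measurable field. [folklore] -/
private theorem eLpNorm_one_norm_mul_norm_self {a : EuclideanSpace ℝ (Fin 3) → EuclideanSpace ℝ (Fin 3)} :
    eLpNorm (fun y => ‖a y‖ * ‖a y‖) 1 volume = ∫⁻ y, ‖a y‖ₑ ^ 2 := by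
  rw [eLpNorm_one_eq_lintegral_enorm]
  refine lintegral_congr fun y => ?_
  rw [← sq, Real.enorm_eq_ofReal (sq_nonneg _), ← ofReal_norm, ENNReal.ofReal_pow (norm_nonneg _)]

/-- **The tail integral** `∫₀ᵗ C (ν(t+s-τ))^{-5/4} dτ ≤ 4 C ν^{-5/4} s^{-1/4}` (`C ≥ 0`, `ν, t, s > 0`),
as an extended real. [folklore] -/
private theorem lintegral_decayWeight_le {C ν t s : ℝ} (hC : 0 ≤ C) (hν : 0 < ν) (ht : 0 < t) (hs : 0 < s) :
    ∫⁻ τ in Ioo 0 t, ENNReal.ofReal (C * (ν * (t + s - τ)) ^ (-(5 / 4 : ℝ))) ≤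
      ENNReal.ofReal (4 * C * ν ^ (-(5 / 4 : ℝ)) * s ^ (-(1 / 4 : ℝ))) := by
  set r : ℝ := -(5 / 4 : ℝ) with hr
  have hpos : ∀ τ ∈ Icc 0 t, 0 < t + s - τ := fun τ hτ => by linarith [hτ.2]
  -- the integrand is continuous on `[0, t]`, hence integrable
  have hcont : ContinuousOn (fun τ : ℝ => C * (ν * (t + s - τ)) ^ r) (Icc 0 t) := by
    refine continuousOn_const.mul (ContinuousOn.rpow_const (by fun_prop) fun τ hτ => ?_)
    exact Or.inl (mul_pos hν (hpos τ hτ)).ne'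
  have hint : IntegrableOn (fun τ : ℝ => C * (ν * (t + s - τ)) ^ r) (Icc 0 t) volume :=
    hcont.integrableOn_compact isCompact_Icc
  have hnn : ∀ τ ∈ Icc 0 t, 0 ≤ C * (ν * (t + s - τ)) ^ r := fun τ hτ =>
    mul_nonneg hC (rpow_nonneg (mul_pos hν (hpos τ hτ)).le _)
  rw [Measure.restrict_congr_set (Ioo_ae_eq_Icc : Ioo (0 : ℝ) t =ᵐ[volume] Icc 0 t),
    ← ofReal_integral_eq_lintegral_ofReal hint
      ((ae_restrict_iff' measurableSet_Icc).2 (Eventually.of_forall hnn))]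
  apply ENNReal.ofReal_le_ofReal
  -- explicit evaluation: `∫₀ᵗ (ν(t+s-τ))^r dτ = ν^r ((t+s)^{r+1} - s^{r+1})/(r+1) · (-1)·(-1)`
  rw [integral_Icc_eq_integral_Ioc, ← intervalIntegral.integral_of_le ht.le,
    intervalIntegral.integral_const_mul]
  have hcongr : ∫ τ in (0 : ℝ)..t, (ν * (t + s - τ)) ^ r = ∫ τ in (0 : ℝ)..t, ν ^ r * (t + s - τ) ^ r := by
    refine intervalIntegral.integral_congr fun τ hτ => ?_
    rw [uIcc_of_le ht.le] at hτ
    exact mul_rpow hν.le (hpos τ hτ).le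
  rw [hcongr, intervalIntegral.integral_const_mul,
    intervalIntegral.integral_comp_sub_left (fun σ : ℝ => σ ^ r) (t + s), add_sub_cancel_left, sub_zero,
    integral_rpow (Or.inr ⟨by rw [hr]; norm_num, ?_⟩)]
  · have hr1 : r + 1 = -(1 / 4 : ℝ) := by rw [hr]; norm_num
    rw [hr1]
    have hts : 0 < t + s := by linarith
    have h1 : (t + s) ^ (-(1 / 4 : ℝ)) ≥ 0 := rpow_nonneg hts.le _
    have h2 : ν ^ r ≥ 0 := rpow_nonneg hν.le _
    -- `C * (ν^r * (((t+s)^{-1/4} - s^{-1/4}) / (-1/4))) ≤ 4 C ν^r s^{-1/4}`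
    have : ν ^ r * (((t + s) ^ (-(1 / 4 : ℝ)) - s ^ (-(1 / 4 : ℝ))) / (-(1 / 4 : ℝ))) ≤
        ν ^ r * (4 * s ^ (-(1 / 4 : ℝ))) := by
      apply mul_le_mul_of_nonneg_left _ h2
      rw [div_neg, ← neg_div, neg_sub]
      have : (s ^ (-(1 / 4 : ℝ)) - (t + s) ^ (-(1 / 4 : ℝ))) / (1 / 4 : ℝ) =
          4 * (s ^ (-(1 / 4 : ℝ)) - (t + s) ^ (-(1 / 4 : ℝ))) := by ring
      rw [this]
      linarith
    calc C * (ν ^ r * (((t + s) ^ (-(1 / 4 : ℝ)) - s ^ (-(1 / 4 : ℝ))) / (-(1 / 4 : ℝ))))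
        ≤ C * (ν ^ r * (4 * s ^ (-(1 / 4 : ℝ)))) := mul_le_mul_of_nonneg_left this hC
      _ = 4 * C * ν ^ r * s ^ (-(1 / 4 : ℝ)) := by ring
  · rw [uIcc_of_le (by linarith : s ≤ t + s)]
    exact fun h => (lt_irrefl (0 : ℝ)) (hs.trans_le h.1)

/-! ### 3. The heat flow of the Duhamel term: semigroup law under the time integral, `L²` size -/

/-- **Time clamp**: a field which is jointly continuous on the closed slab `[0, T] × ℝ³` and bounded
there has a globally (jointly) measurable extension with the same bound agreeing with it on `[0, T]`
(clamp the time variable to `[0, T]`). [folklore] -/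
private theorem exists_measurable_clamp {T M : ℝ} (hT : 0 < T)
    {u : ℝ → EuclideanSpace ℝ (Fin 3) → EuclideanSpace ℝ (Fin 3)}
    (hu : ContinuousOn (uncurry u) (Icc 0 T ×ˢ univ)) (hM : ∀ t ∈ Icc 0 T, ∀ y, ‖u t y‖ ≤ M) :
    ∃ w : ℝ → EuclideanSpace ℝ (Fin 3) → EuclideanSpace ℝ (Fin 3), Measurable (uncurry w) ∧
      (∀ τ y, ‖w τ y‖ ≤ M) ∧ ∀ τ ∈ Icc 0 T, w τ = u τ := by
  refine ⟨fun τ y => u (max 0 (min τ T)) y, ?_, ?_, ?_⟩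
  · have hg : Continuous fun z : ℝ × EuclideanSpace ℝ (Fin 3) => (max 0 (min z.1 T), z.2) := by fun_prop
    have hmem : ∀ z : ℝ × EuclideanSpace ℝ (Fin 3), (max 0 (min z.1 T), z.2) ∈ Icc 0 T ×ˢ univ :=
      fun z => ⟨⟨le_max_left _ _, max_le hT.le (min_le_right _ _)⟩, mem_univ _⟩
    have hc : Continuous fun z : ℝ × EuclideanSpace ℝ (Fin 3) => u (max 0 (min z.1 T)) z.2 :=
      hu.comp_continuous hg hmem
    exact hc.measurable
  · intro τ y
    exact hM _ ⟨le_max_left _ _, max_le hT.le (min_le_right _ _)⟩ y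
  · intro τ hτ
    have : max 0 (min τ T) = τ := by
      rw [min_eq_left hτ.2, max_eq_right hτ.1]
    simp only [this]

/-- **The `L²` size of the heat flow of the Duhamel term through the energy**: there is a universal
`C ≥ 0` such that for every jointly measurable field `w` on `ℝ × ℝ³` with `∫|w(τ)|² ≤ A` on `(0, t)`,
every `ν, s > 0` and `t > 0`,
`‖∫₀ᵗ N_{ν(t+s-τ)}[w(τ), w(τ)] dτ‖_{L²} ≤ A · C ν^{-5/4} s^{-1/4}`
(Minkowski in time, the `L¹ → L²` slice bound `C₀ σ^{-5/4}‖w(τ)‖₂²`, and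
`∫₀ᵗ (ν(t+s-τ))^{-5/4} dτ ≤ 4 ν^{-5/4} s^{-1/4}`). The point: uniform in `t`, and `→ 0` as
`s → ∞`. [cite: Kato1984, §2 (2.3)–(2.4')] -/
theorem exists_eLpNorm_two_heat_oseenDuhamel_le :
    ∃ C : ℝ, 0 ≤ C ∧ ∀ {ν : ℝ}, 0 < ν →
      ∀ {w : ℝ → EuclideanSpace ℝ (Fin 3) → EuclideanSpace ℝ (Fin 3)}, Measurable (uncurry w) →
        ∀ {A : ℝ≥0∞} {t s : ℝ}, 0 < t → 0 < s → (∀ τ ∈ Ioo 0 t, ∫⁻ y, ‖w τ y‖ₑ ^ 2 ≤ A) →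
          eLpNorm (fun x => ∫ τ in Ioo 0 t, ∫ y, oseenKernel (ν * (t + s - τ)) (x - y) (w τ y) (w τ y))
              2 volume ≤
            A * ENNReal.ofReal (C * ν ^ (-(5 / 4 : ℝ)) * s ^ (-(1 / 4 : ℝ))) := by
  obtain ⟨C₀, hC₀, hslice⟩ := exists_eLpNorm_two_oseenSlice_le_eLpNorm_one
  refine ⟨4 * C₀, by positivity, fun {ν} hν {w} hwm {A} {t} {s} ht hs hA => ?_⟩
  have h12 : (1 : ℝ≥0∞) ≤ 2 := by norm_num
  -- Minkowski's inequality in time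
  have hF := aestronglyMeasurable_oseenIntegrand_swap hwm hwm ν (t + s)
    ((volume : Measure ℝ).restrict (Ioo 0 t))
  have hmink := FunctionSpaces.eLpNorm_integral_le_lintegral_eLpNorm
    (μ := (volume : Measure (EuclideanSpace ℝ (Fin 3))))
    (ν := (volume : Measure ℝ).restrict (Ioo 0 t)) hF h12 ENNReal.ofNat_ne_top
  refine hmink.trans ?_
  -- slice-wise bound
  have hwτ : ∀ τ, Measurable (w τ) := fun τ => hwm.comp (measurable_const.prodMk measurable_id)
  have hpt : ∀ τ ∈ Ioo 0 t,
      eLpNorm (fun x => ∫ y, oseenKernel (ν * (t + s - τ)) (x - y) (w τ y) (w τ y)) 2 volume ≤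
        ENNReal.ofReal (C₀ * (ν * (t + s - τ)) ^ (-(5 / 4 : ℝ))) * A := by
    intro τ hτ
    have hσ : 0 < ν * (t + s - τ) := mul_pos hν (by linarith [hτ.2])
    refine (hslice hσ (hwτ τ).aestronglyMeasurable (hwτ τ).aestronglyMeasurable).trans ?_
    rw [eLpNorm_one_norm_mul_norm_self]
    gcongr
    exact hA τ hτ
  calc ∫⁻ τ in Ioo 0 t,
        eLpNorm (fun x => ∫ y, oseenKernel (ν * (t + s - τ)) (x - y) (w τ y) (w τ y)) 2 volume
      ≤ ∫⁻ τ in Ioo 0 t, ENNReal.ofReal (C₀ * (ν * (t + s - τ)) ^ (-(5 / 4 : ℝ))) * A :=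
        setLIntegral_mono' measurableSet_Ioo hpt
    _ = (∫⁻ τ in Ioo 0 t, ENNReal.ofReal (C₀ * (ν * (t + s - τ)) ^ (-(5 / 4 : ℝ)))) * A := by
        refine lintegral_mul_const _ ?_
        exact (measurable_const.mul ((measurable_const.mul
          (measurable_const.sub measurable_id)).pow_const _)).ennreal_ofReal
    _ ≤ ENNReal.ofReal (4 * C₀ * ν ^ (-(5 / 4 : ℝ)) * s ^ (-(1 / 4 : ℝ))) * A := by
        gcongr
        exact lintegral_decayWeight_le hC₀ hν ht hs
    _ = A * ENNReal.ofReal (4 * C₀ * ν ^ (-(5 / 4 : ℝ)) * s ^ (-(1 / 4 : ℝ))) := mul_comm _ _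

/-- **The heat flow of the Duhamel term through a clamped field**: for a field jointly continuous on
`[0, T] × ℝ³` and bounded by `M` there, there is a globally measurable field `w`, bounded by `M`,
with `w(τ) = u(τ)` for `τ ∈ [0, T]`, such that for all `0 < t ≤ T`, `s > 0`,
`e^{νsΔ} B^ν_0(u,u)(t) = ∫₀ᵗ N_{ν(t+s-τ)}[w(τ), w(τ)] dτ` pointwise. [cite: LemarieRieusset2016, Prop. 6.4 (6.10)] -/
theorem exists_clamp_heatExtension_oseenDuhamel_eq {ν T M : ℝ} (hν : 0 < ν) (hT : 0 < T)
    {u : ℝ → EuclideanSpace ℝ (Fin 3) → EuclideanSpace ℝ (Fin 3)}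
    (hu : ContinuousOn (uncurry u) (Icc 0 T ×ˢ univ)) (hM : ∀ t ∈ Icc 0 T, ∀ y, ‖u t y‖ ≤ M) :
    ∃ w : ℝ → EuclideanSpace ℝ (Fin 3) → EuclideanSpace ℝ (Fin 3), Measurable (uncurry w) ∧
      (∀ τ y, ‖w τ y‖ ≤ M) ∧ (∀ τ ∈ Icc 0 T, w τ = u τ) ∧
        ∀ {t s : ℝ}, t ∈ Ioc 0 T → 0 < s → ∀ x : EuclideanSpace ℝ (Fin 3),
          heatExtension (oseenDuhamel ν 0 u u t) (ν * s) x =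
            ∫ τ in Ioo 0 t, ∫ y, oseenKernel (ν * (t + s - τ)) (x - y) (w τ y) (w τ y) := by
  obtain ⟨w, hwm, hwM, hw⟩ := exists_measurable_clamp hT hu hM
  refine ⟨w, hwm, hwM, hw, fun {t} {s} ht hs x => ?_⟩
  have hsub : ∀ τ ∈ Ioo 0 t, τ ∈ Icc 0 T := fun τ hτ => ⟨hτ.1.le, hτ.2.le.trans ht.2⟩
  have h1 : oseenDuhamel ν 0 u u t = oseenDuhamel ν 0 w w t := by
    funext z
    simp only [oseenDuhamel_apply]
    refine setIntegral_congr_fun measurableSet_Ioo fun τ hτ => ?_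
    simp only [hw τ (hsub τ hτ)]
  have h2 := heatExtension_oseenDuhamel_eq_setIntegral hν hwm hwM (s₀ := 0) (s := t) (t := t + s)
    ht.1 (by linarith) x
  rw [add_sub_cancel_left] at h2
  rw [h1, h2]

end EnergyDecay

end Literature.Analysis.FluidPDE

end
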